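import Literature.NumberTheory.EllipticCurves.EisensteinSeriesTwoCharacterWeightOne
import Literature.NumberTheory.EllipticCurves.EisensteinSeriesTwoCharacterQExpansion
import Literature.NumberTheory.LFunctions.DirichletCharacterPrimitiveProduct
import Literature.NumberTheory.LFunctions.CotangentCharacterSum
import HarnessLib

/-!
# Constant terms of the weight-`1` two-character Eisenstein series `S_1^{ψ,φ}` at the cusps
# `a/c` with `gcd(c, u) = 1`

Topic `Literature/NumberTheory/EllipticCurves`; namespace
`Literature.NumberTheory.EllipticCurves.ModularForms`.  Definitions with bodies (`sawtoothConst`,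
`twoCharOneCuspI`, `twoCharOneCuspII`) and theorems; no named fact.

For `ψ` modulo `u`, `φ` modulo `v` and `γ = (a b; c d) ∈ SL₂(ℤ)` the constant term of
`S_1^{ψ,φ} ∣₁ γ` at `i∞` is the finite character sum
`twoCharOneCusp ψ φ γ = ∑_{c₁, d₀} ψ(c₁) φ̄(d₀) C_{(vc₁,d₀)γ}`
(`EisensteinSeriesTwoCharacterWeightOne`) of the constants `C_w` of the corrected `ζ`-division values,
`C_w = 2πi (w₀/N - 1/2)` for `w₀ ≠ 0` and `C_w = π cot(π w₁/N)` for `w₀ = 0` (`N = uv`,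
`eisensteinOneDivConstZ_eq`).  Accordingly the cusp sum splits into a **sawtooth part**
(`twoCharOneCuspI`, the terms `w₀ ≠ 0`) and a **cotangent part** (`twoCharOneCuspII`, the terms
`w₀ = 0`) — the two constant terms `δ(φ) L(0, ψ)` and `δ(ψ) L(0, φ)` of the weight-one Eisenstein
series (Diamond–Shurman Thm. 4.8.1), seen from an arbitrary cusp.  We prove, at the cusps with
`gcd(c, u) = 1` (the only ones at which the companion series `E_b^{ψ̄,𝟙}` of the level-raising
products do not vanish):

* `twoCharOneCuspI_eq_zero` — **the sawtooth part vanishes** for `ψ ≠ 𝟙` (averaging `d₀` over the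
  translates `d₀ + v j`, `j mod u`, which do not change `φ̄(d₀)`: the inner sum becomes independent
  of `c₁`, and `∑_{c₁} ψ(c₁) = 0`);
* `twoCharOneCuspII_eq_zero_of_not_dvd` — **the cotangent part vanishes unless `v ∣ c`**;
* `twoCharOneCuspII_of_eq_mul` — for `c = v c'`, `gcd(c', u) = 1`, `gcd(u, v) = 1`:
  **`= ψ(-c') φ̄(a) ∑_{x mod uv} ψ(x) φ̄(x) π cot(π x/(uv))`** (the solutions of
  `(v c₁, d₀)γ ≡ (0, x)` are `c₁ = -x c'`, `d₀ = x a`);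

whence `twoCharOneCusp_of_not_dvd` (`= 0`) and `twoCharOneCusp_of_eq_mul`.  For `ψ`, `φ`
primitive with coprime conductors the remaining character sum is `2πi τ(Λ) B_{1,Λ̄}`,
`Λ = ψφ̄ (mod uv)` (`sum_castHom_mul_cotConst_eq`, from
`LFunctions.sum_mul_pi_mul_cot_eq_gaussSum_mul_bernoulli`): the constant terms of `S_1^{ψ,φ}`
above the cusp `1/v` are a Gauss sum times a first generalized Bernoulli number
(`twoCharOneCusp_of_eq_mul_eq_bernoulli`), as in Diamond–Shurman Thm. 4.8.1 (`δ(ψ) L(0, φ)`,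
`L(0, φ) = -B_{1,φ}`) seen from the cusp `1/v`.

## References

* E. Hecke, *Theorie der Eisensteinschen Reihen höherer Stufe…*, Abh. Math. Sem. Hamburg 5 (1927),
  §§2–3.
* F. Diamond, J. Shurman, *A First Course in Modular Forms*, GTM 228 (2005), §4.8 (Thm. 4.8.1).
  [DiamondShurman2005]
-/

noncomputable section

open UpperHalfPlane hiding I
open EisensteinSeries ModularForm CongruenceSubgroup Complex Filter Function Matrix

open scoped Real MatrixGroups

namespace Literature.NumberTheory.EllipticCurves.ModularForms

/-! ### The constants `C_w` in closed form -/

section Const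

variable (N : ℕ) [NeZero N]

/-- The **sawtooth constant** `2πi (x/N - 1/2)` for `x ≠ 0`, `0` for `x = 0` (`x ∈ ℤ/N` through its
canonical representative `0 ≤ x < N`): `2πi` times the first periodic Bernoulli function.
[folklore] -/
def sawtoothConst (x : ZMod N) : ℂ :=
  if x = 0 then 0 else 2 * π * I * (((x.val : ℕ) : ℂ) / N - 1 / 2)

/-- The **cotangent constant** `π cot(π x/N)` (`x ∈ ℤ/N` through its canonical representative; `0`
for `x = 0` with Lean's `cot 0 = 0`). [folklore] -/
def cotConst (x : ZMod N) : ℂ := π * Complex.cot (π * (((x.val : ℕ) : ℂ) / N))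

omit [NeZero N] in
/-- `cotConst N 0 = 0`. [folklore] -/
@[simp] theorem cotConst_zero : cotConst N 0 = 0 := by
  simp [cotConst, Complex.cot]

omit [NeZero N] in
/-- `sawtoothConst N 0 = 0`. [folklore] -/
@[simp] theorem sawtoothConst_zero : sawtoothConst N 0 = 0 := by
  simp [sawtoothConst]

/-- **`C_w` in closed form**: `π cot(π w₁/N)` if `w₀ = 0` (this is `0` for `w = 0`), and
`2πi (w₀/N - 1/2) = 2πi B₁(w₀/N)` (`0 < w₀ < N` the canonical representative) otherwise.
[cite: DiamondShurman2005, §4.8] -/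
theorem eisensteinOneDivConstZ_eq (w : Fin 2 → ZMod N) :
    eisensteinOneDivConstZ N w = if w 0 = 0 then cotConst N (w 1) else sawtoothConst N (w 0) := by
  unfold eisensteinOneDivConstZ
  by_cases h0 : w 0 = 0
  · rw [if_pos h0]
    by_cases h1 : w 1 = 0
    · -- `w = 0`: both sides vanish
      have hdvd : (N : ℤ) ∣ (((w 0).val : ℕ) : ℤ) ∧ (N : ℤ) ∣ (((w 1).val : ℕ) : ℤ) := by
        rw [h0, h1, ZMod.val_zero]; simp
      rw [eisensteinOneDivConst, if_pos hdvd, h1, cotConst_zero]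
    · have hv0 : ((fun i ↦ (((w i).val : ℕ) : ℤ)) 0) = 0 := by simp [h0]
      have hv1 : ¬ (N : ℤ) ∣ ((fun i ↦ (((w i).val : ℕ) : ℤ)) 1) := by
        simp only
        rw [Int.natCast_dvd_natCast]
        intro h
        apply h1
        have hlt := ZMod.val_lt (w 1)
        have : (w 1).val = 0 := Nat.eq_zero_of_dvd_of_lt h hlt
        exact (ZMod.val_eq_zero _).mp this
      rw [eisensteinOneDivConst_eq_of_eq_zero _ hv0 hv1, cotConst]
      simp
  · rw [if_neg h0, sawtoothConst, if_neg h0]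
    have hpos : 0 < ((fun i ↦ (((w i).val : ℕ) : ℤ)) 0) := by
      simp only [Nat.cast_pos]
      exact Nat.pos_of_ne_zero fun h ↦ h0 ((ZMod.val_eq_zero _).mp h)
    have hlt : ((fun i ↦ (((w i).val : ℕ) : ℤ)) 0) < N := by
      simp only [Nat.cast_lt]
      exact ZMod.val_lt (w 0)
    rw [eisensteinOneDivConst_eq_of_pos_of_lt _ hpos hlt]
    simp

end Const

/-! ### The two parts of the cusp sum -/

section TwoChar

variable {u v : ℕ} [NeZero u] [NeZero v] (ψ : DirichletCharacter ℂ u) (φ : DirichletCharacter ℂ v)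

/-- The **sawtooth part** of the cusp sum: the terms with `((vc₁, d₀)γ)₀ ≠ 0`. [folklore] -/
def twoCharOneCuspI (γ : SL(2, ℤ)) : ℂ :=
  ∑ c₁ : ZMod u, ∑ d₀ : ZMod (u * v), tcWeight ψ φ c₁ d₀ *
    sawtoothConst (u * v) (((tcVec c₁ d₀ : Fin 2 → ZMod (u * v)) ᵥ* γ) (0 : Fin 2))

/-- The **cotangent part** of the cusp sum: the terms with `((vc₁, d₀)γ)₀ = 0`. [folklore] -/
def twoCharOneCuspII (γ : SL(2, ℤ)) : ℂ :=
  ∑ c₁ : ZMod u, ∑ d₀ : ZMod (u * v), tcWeight ψ φ c₁ d₀ *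
    (if ((tcVec c₁ d₀ : Fin 2 → ZMod (u * v)) ᵥ* γ) (0 : Fin 2) = 0 then
      cotConst (u * v) (((tcVec c₁ d₀ : Fin 2 → ZMod (u * v)) ᵥ* γ) (1 : Fin 2))
    else 0)

/-- **`twoCharOneCusp = I + II`.** [folklore] -/
theorem twoCharOneCusp_eq_add (γ : SL(2, ℤ)) :
    twoCharOneCusp ψ φ γ = twoCharOneCuspI ψ φ γ + twoCharOneCuspII ψ φ γ := by
  unfold twoCharOneCusp twoCharOneCuspI twoCharOneCuspII
  rw [← Finset.sum_add_distrib]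
  refine Finset.sum_congr rfl fun c₁ _ ↦ ?_
  rw [← Finset.sum_add_distrib]
  refine Finset.sum_congr rfl fun d₀ _ ↦ ?_
  rw [← mul_add, eisensteinOneDivConstZ_eq]
  congr 1
  split_ifs with h
  · rw [h, sawtoothConst_zero, zero_add]
  · rw [add_zero]

/-! ### The sawtooth part vanishes (`gcd(c, u) = 1`, `ψ ≠ 𝟙`) -/

omit [NeZero v] in
/-- `vMul` is additive. [folklore] -/
theorem vMul_add (j j' : ZMod u) : vMul (v := v) (j + j') = vMul j + vMul j' := by
  have hj : j = ((j.val : ℤ) : ZMod u) := by rw [Int.cast_natCast, ZMod.natCast_zmod_val]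
  have hj' : j' = ((j'.val : ℤ) : ZMod u) := by rw [Int.cast_natCast, ZMod.natCast_zmod_val]
  rw [hj, hj', ← Int.cast_add, vMul_intCast, vMul_intCast, vMul_intCast]
  push_cast
  ring

/-- `vMul` of the reduction modulo `u` of `w ∈ ℤ/uv` is `v · w`. [folklore] -/
theorem vMul_castHom (w : ZMod (u * v)) :
    vMul (v := v) (ZMod.castHom (dvd_mul_right u v) (ZMod u) w) = (v : ZMod (u * v)) * w := by
  have hw : w = ((w.val : ℤ) : ZMod (u * v)) := by rw [Int.cast_natCast, ZMod.natCast_zmod_val]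
  conv_lhs => rw [hw, map_intCast, vMul_intCast]
  conv_rhs => rw [hw]
  push_cast
  ring

omit [NeZero u] [NeZero v] in
/-- The weight does not see translations of `d₀` by multiples of `v`. [folklore] -/
theorem tcWeight_add_vMul (c₁ j : ZMod u) (d₀ : ZMod (u * v)) :
    tcWeight ψ φ c₁ (d₀ + vMul j) = tcWeight ψ φ c₁ d₀ := by
  simp only [tcWeight, map_add, castHom_vMul, add_zero]

omit [NeZero v] in
/-- The orbit sum `∑_{j mod u} F(y + v j)` is invariant under `y ↦ y + v t`. [folklore] -/
theorem sum_vMul_add_invariant (F : ZMod (u * v) → ℂ) (y : ZMod (u * v)) (t : ZMod u) :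
    ∑ j : ZMod u, F (y + vMul t + vMul j) = ∑ j : ZMod u, F (y + vMul j) := by
  refine Fintype.sum_equiv (Equiv.addLeft t) _ _ fun j ↦ ?_
  simp only [Equiv.coe_addLeft, vMul_add]
  ring_nf

/-- **The sawtooth part vanishes** at every cusp `a/c` with `gcd(c, u) = 1`, provided `ψ ≠ 𝟙`.
[cite: DiamondShurman2005, §4.8] -/
theorem twoCharOneCuspI_eq_zero (hψ : ψ ≠ 1) {γ : SL(2, ℤ)} (hc : IsCoprime (γ 1 0 : ℤ) u) :
    twoCharOneCuspI ψ φ γ = 0 := by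
  classical
  have hu : (u : ℂ) ≠ 0 := by exact_mod_cast NeZero.ne u
  set A : ZMod (u * v) := ((γ 0 0 : ℤ) : ZMod (u * v)) with hA
  set C : ZMod (u * v) := ((γ 1 0 : ℤ) : ZMod (u * v)) with hC
  -- `c` is a unit modulo `u`
  obtain ⟨cU, hcU⟩ : ∃ cU : (ZMod u)ˣ, (cU : ZMod u) = ((γ 1 0 : ℤ) : ZMod u) := by
    have : IsUnit (((γ 1 0 : ℤ) : ZMod u)) := by
      obtain ⟨s, t, hst⟩ := hc
      refine IsUnit.of_mul_eq_one ((s : ZMod u)) ?_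
      have := congrArg ((↑) : ℤ → ZMod u) hst
      push_cast at this
      rw [ZMod.natCast_self, mul_zero, add_zero, mul_comm] at this
      exact this
    exact ⟨this.unit, this.unit_spec⟩
  -- the orbit sum `S(y) = ∑_j B(y + v j)`
  set B : ZMod (u * v) → ℂ := sawtoothConst (u * v) with hB
  set S : ZMod (u * v) → ℂ := fun y ↦ ∑ j : ZMod u, B (y + vMul j) with hS
  -- the first coordinate of `(vc₁, d₀)γ`
  have h0 : ∀ (c₁ : ZMod u) (d₀ : ZMod (u * v)),
      ((tcVec c₁ d₀ : Fin 2 → ZMod (u * v)) ᵥ* γ) (0 : Fin 2) = vMul c₁ * A + d₀ * C := by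
    intro c₁ d₀
    rw [tcVec_vecMul]
    simp [hA, hC]
  -- Step 1: for every `j`, translate `d₀ ↦ d₀ + v j`
  have hstep : ∀ j : ZMod u, twoCharOneCuspI ψ φ γ =
      ∑ c₁ : ZMod u, ∑ d₀ : ZMod (u * v), tcWeight ψ φ c₁ d₀ *
        B (vMul c₁ * A + d₀ * C + vMul (j * (cU : ZMod u))) := by
    intro j
    unfold twoCharOneCuspI
    refine Finset.sum_congr rfl fun c₁ _ ↦ ?_
    simp_rw [h0]
    refine (Fintype.sum_equiv (Equiv.addRight (vMul j)) _ _ fun d₀ ↦ ?_).symm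
    rw [Equiv.coe_addRight, tcWeight_add_vMul, hcU, vMul_mul_intCast]
    congr 2
    ring
  -- Step 2: average over `j`
  have havg : (u : ℂ) * twoCharOneCuspI ψ φ γ =
      ∑ c₁ : ZMod u, ∑ d₀ : ZMod (u * v), tcWeight ψ φ c₁ d₀ * S (vMul c₁ * A + d₀ * C) := by
    have h1 : (u : ℂ) * twoCharOneCuspI ψ φ γ = ∑ j : ZMod u, twoCharOneCuspI ψ φ γ := by
      rw [Finset.sum_const, Finset.card_univ, ZMod.card, nsmul_eq_mul]
    rw [h1, Finset.sum_congr rfl fun j _ ↦ hstep j, Finset.sum_comm]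
    refine Finset.sum_congr rfl fun c₁ _ ↦ ?_
    rw [Finset.sum_comm]
    refine Finset.sum_congr rfl fun d₀ _ ↦ ?_
    rw [← Finset.mul_sum]
    congr 1
    -- `∑_j B(y + v (j c)) = ∑_j B(y + v j)`
    exact Fintype.sum_equiv (Units.mulRight cU) _ _ fun j ↦ rfl
  -- Step 3: `S(v c₁ A + d₀ C) = S(d₀ C)`
  have hinv : ∀ (c₁ : ZMod u) (d₀ : ZMod (u * v)), S (vMul c₁ * A + d₀ * C) = S (d₀ * C) := by
    intro c₁ d₀
    have h := sum_vMul_add_invariant B (d₀ * C) (c₁ * ((γ 0 0 : ℤ) : ZMod u))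
    rw [vMul_mul_intCast] at h
    rw [hS]
    simp only
    rw [show vMul c₁ * A + d₀ * C = d₀ * C + vMul c₁ * A by ring]
    exact h
  -- Step 4: factor `∑ ψ = 0`
  have hfac : (u : ℂ) * twoCharOneCuspI ψ φ γ =
      (∑ c₁ : ZMod u, ψ c₁) * ∑ d₀ : ZMod (u * v),
        φ⁻¹ (ZMod.castHom (dvd_mul_left v u) (ZMod v) d₀) * S (d₀ * C) := by
    rw [havg, Finset.sum_mul]
    refine Finset.sum_congr rfl fun c₁ _ ↦ ?_
    rw [Finset.mul_sum]
    refine Finset.sum_congr rfl fun d₀ _ ↦ ?_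
    rw [hinv, tcWeight]
    ring
  rw [MulChar.sum_eq_zero_of_ne_one hψ, zero_mul] at hfac
  exact (mul_eq_zero.mp hfac).resolve_left hu

/-! ### The cotangent part -/

/-- **The cotangent part vanishes unless `v ∣ c`** (if `((vc₁,d₀)γ)₀ = 0` then `d₀ c ≡ 0 (mod v)`;
a non-zero weight forces `d₀` to be a unit modulo `v`, hence `v ∣ c`). [cite: DiamondShurman2005, §4.8] -/
theorem twoCharOneCuspII_eq_zero_of_not_dvd {γ : SL(2, ℤ)} (h : ¬ (v : ℤ) ∣ (γ 1 0 : ℤ)) :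
    twoCharOneCuspII ψ φ γ = 0 := by
  classical
  unfold twoCharOneCuspII
  refine Finset.sum_eq_zero fun c₁ _ ↦ Finset.sum_eq_zero fun d₀ _ ↦ ?_
  by_cases h0 : ((tcVec c₁ d₀ : Fin 2 → ZMod (u * v)) ᵥ* γ) (0 : Fin 2) = 0
  · -- the weight vanishes
    have hw : tcWeight ψ φ c₁ d₀ = 0 := by
      rw [tcVec_vecMul] at h0
      simp only [Matrix.cons_val_zero] at h0
      have h1 := congrArg (ZMod.castHom (dvd_mul_left v u) (ZMod v)) h0
      rw [map_add, map_mul, map_mul, castHom_vMul, zero_mul, zero_add, map_intCast, map_zero] at h1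
      have hnu : ¬ IsUnit (ZMod.castHom (dvd_mul_left v u) (ZMod v) d₀) := by
        intro hu
        apply h
        obtain ⟨w, hw⟩ := hu
        rw [← hw] at h1
        have : ((γ 1 0 : ℤ) : ZMod v) = 0 := by
          have := congrArg (fun x : ZMod v ↦ ((w⁻¹ : (ZMod v)ˣ) : ZMod v) * x) h1
          simpa using this
        exact (ZMod.intCast_zmod_eq_zero_iff_dvd _ _).mp this
      rw [tcWeight, MulChar.map_nonunit _ hnu, mul_zero]
    rw [hw, zero_mul]
  · rw [if_neg h0, mul_zero]

/-- **The cotangent part for `c = v c'` (`gcd(u, v) = 1`):**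
`II = ψ(-c') φ̄(a) ∑_{x mod uv} ψ(x) φ̄(x) π cot(π x/(uv))` (the solutions of `((vc₁,d₀)γ)₀ = 0`
are `(c₁, d₀) = (-x c', x a)` with `((vc₁,d₀)γ)₁ = x`, `x ∈ ℤ/uv`; the value vanishes unless
`gcd(c', u) = 1`). [cite: DiamondShurman2005, §4.8] -/
theorem twoCharOneCuspII_of_eq_mul (huv : u.Coprime v) {γ : SL(2, ℤ)} (c' : ℤ)
    (h : (γ 1 0 : ℤ) = v * c') :
    twoCharOneCuspII ψ φ γ =
      ψ ((-c' : ℤ) : ZMod u) * φ⁻¹ ((γ 0 0 : ℤ) : ZMod v) *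
        ∑ x : ZMod (u * v), ψ (ZMod.castHom (dvd_mul_right u v) (ZMod u) x) *
          φ⁻¹ (ZMod.castHom (dvd_mul_left v u) (ZMod v) x) * cotConst (u * v) x := by
  classical
  -- notation
  set A : ZMod (u * v) := ((γ 0 0 : ℤ) : ZMod (u * v)) with hA
  set Bm : ZMod (u * v) := ((γ 0 1 : ℤ) : ZMod (u * v)) with hBm
  set C : ZMod (u * v) := ((γ 1 0 : ℤ) : ZMod (u * v)) with hC
  set D : ZMod (u * v) := ((γ 1 1 : ℤ) : ZMod (u * v)) with hD
  set πu := ZMod.castHom (dvd_mul_right u v) (ZMod u) with hπu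
  set πv := ZMod.castHom (dvd_mul_left v u) (ZMod v) with hπv
  have hdet : A * D - Bm * C = 1 := det_cast γ
  have hCv : C = (v : ZMod (u * v)) * (c' : ZMod (u * v)) := by
    rw [hC, h]; push_cast; ring
  -- the two coordinates of `(vc₁, d₀)γ`
  have h0 : ∀ (c₁ : ZMod u) (d₀ : ZMod (u * v)),
      ((tcVec c₁ d₀ : Fin 2 → ZMod (u * v)) ᵥ* γ) (0 : Fin 2) = vMul c₁ * A + d₀ * C := by
    intro c₁ d₀; rw [tcVec_vecMul]; simp [hA, hC]
  have h1 : ∀ (c₁ : ZMod u) (d₀ : ZMod (u * v)),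
      ((tcVec c₁ d₀ : Fin 2 → ZMod (u * v)) ᵥ* γ) (1 : Fin 2) = vMul c₁ * Bm + d₀ * D := by
    intro c₁ d₀; rw [tcVec_vecMul]; simp [hBm, hD]
  -- the determinant modulo `u`, and the units `v`, `c'`, `a` modulo `u`, `u`, `v`
  have hdet_u : ((γ 0 0 : ℤ) : ZMod u) * ((γ 1 1 : ℤ) : ZMod u) -
      ((γ 0 1 : ℤ) : ZMod u) * ((v : ZMod u) * (c' : ZMod u)) = 1 := by
    have := congrArg πu hdet
    rw [map_sub, map_mul, map_mul, hCv, map_mul, map_one] at this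
    simpa [hπu, hA, hBm, hD] using this
  have hvu : IsUnit ((v : ZMod u)) := by
    rw [ZMod.isUnit_iff_coprime]; exact huv.symm
  -- the parametrisation `x ↦ (c₁, d₀) = (-x c', x a)`
  set g : ZMod (u * v) → ZMod u × ZMod (u * v) := fun x ↦ (-(πu x) * (c' : ZMod u), x * A) with hg
  -- unfold the double sum into a sum over pairs and restrict to the solutions
  have hsum : twoCharOneCuspII ψ φ γ = ∑ p ∈ (Finset.univ : Finset (ZMod u × ZMod (u * v))).filter
      (fun p ↦ vMul p.1 * A + p.2 * C = 0), tcWeight ψ φ p.1 p.2 *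
        cotConst (u * v) (vMul p.1 * Bm + p.2 * D) := by
    unfold twoCharOneCuspII
    rw [← Finset.sum_product', Finset.univ_product_univ, Finset.sum_filter]
    refine Finset.sum_congr rfl fun p _ ↦ ?_
    rw [h0, h1]
    split_ifs <;> simp
  rw [hsum]
  -- the bijection with `ℤ/uv`
  symm
  rw [Finset.mul_sum]
  have hgx : ∀ x : ZMod (u * v), -(πu x) * (c' : ZMod u) = πu (-x * (c' : ZMod (u * v))) := by
    intro x
    rw [map_mul, map_neg, map_intCast]
  refine Finset.sum_bij' (fun x _ ↦ g x) (fun p _ ↦ vMul p.1 * Bm + p.2 * D) ?_ ?_ ?_ ?_ ?_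
  · -- `g x` is a solution
    intro x _
    simp only [Finset.mem_filter, Finset.mem_univ, true_and, hg]
    rw [hgx, vMul_castHom, hCv]
    ring
  · intro p _
    exact Finset.mem_univ _
  · -- `w (g x) = x`
    intro x _
    simp only [hg]
    rw [hgx, vMul_castHom]
    linear_combination x * hdet + (x * Bm) * hCv
  · -- `g (w p) = p` for a solution `p`
    rintro ⟨c₁, d₀⟩ hp
    simp only [Finset.mem_filter, Finset.mem_univ, true_and] at hp
    simp only [hg, Prod.mk.injEq]
    constructor
    · -- first coordinate, modulo `u`
      have hvc : πu (vMul c₁) = (v : ZMod u) * c₁ := by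
        show πu (((v * c₁.val : ℕ)) : ZMod (u * v)) = _
        rw [map_natCast, Nat.cast_mul, ZMod.natCast_zmod_val]
      have hA' : πu A = ((γ 0 0 : ℤ) : ZMod u) := by rw [hA, map_intCast]
      have hB' : πu Bm = ((γ 0 1 : ℤ) : ZMod u) := by rw [hBm, map_intCast]
      have hD' : πu D = ((γ 1 1 : ℤ) : ZMod u) := by rw [hD, map_intCast]
      have hpu := congrArg πu hp
      rw [map_add, map_mul, map_mul, hCv, map_mul, map_zero, hvc, hA', map_natCast, map_intCast]
        at hpu
      -- `v (c₁ a + d₀ c') = 0`, and `v` is a unit mod `u`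
      have hkey : c₁ * ((γ 0 0 : ℤ) : ZMod u) + πu d₀ * (c' : ZMod u) = 0 := by
        have : (v : ZMod u) * (c₁ * ((γ 0 0 : ℤ) : ZMod u) + πu d₀ * (c' : ZMod u)) = 0 := by
          linear_combination hpu
        exact (hvu.mul_right_eq_zero).mp this
      rw [map_add, map_mul, map_mul, hvc, hB', hD']
      linear_combination c₁ * hdet_u - ((γ 1 1 : ℤ) : ZMod u) * hkey
    · -- second coordinate
      linear_combination d₀ * hdet + Bm * hp
  · -- the summands agree
    intro x _
    simp only [hg]
    have hsol : vMul (-(πu x) * (c' : ZMod u)) * Bm + x * A * D = x := by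
      rw [hgx, vMul_castHom]
      linear_combination x * hdet + (x * Bm) * hCv
    rw [hsol, tcWeight]
    have hx : ψ (-(πu x) * (c' : ZMod u)) = ψ ((-c' : ℤ) : ZMod u) * ψ (πu x) := by
      rw [← map_mul]
      congr 1
      push_cast
      ring
    have hφ : φ⁻¹ (πv (x * A)) = φ⁻¹ (πv x) * φ⁻¹ (((γ 0 0 : ℤ) : ZMod v)) := by
      rw [map_mul, hA, map_intCast, map_mul]
    rw [hx, hφ]
    ring

/-! ### The cusp sum at the cusps with `gcd(c, u) = 1` -/

/-- **Constant term of `S_1^{ψ,φ} ∣₁ γ` at a cusp `a/c` with `gcd(c, u) = 1`, `v ∤ c`: zero**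
(`ψ ≠ 𝟙`). [cite: DiamondShurman2005, §4.8 (Thm. 4.8.1)] -/
theorem twoCharOneCusp_of_not_dvd (hψ : ψ ≠ 1) {γ : SL(2, ℤ)} (hc : IsCoprime (γ 1 0 : ℤ) u)
    (h : ¬ (v : ℤ) ∣ (γ 1 0 : ℤ)) : twoCharOneCusp ψ φ γ = 0 := by
  rw [twoCharOneCusp_eq_add, twoCharOneCuspI_eq_zero ψ φ hψ hc,
    twoCharOneCuspII_eq_zero_of_not_dvd ψ φ h, add_zero]

/-- **Constant term of `S_1^{ψ,φ} ∣₁ γ` at a cusp `a/c` with `c = v c'`, `gcd(c, u) = 1`**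
(`ψ ≠ 𝟙`, `gcd(u, v) = 1`): `ψ(-c') φ̄(a) ∑_{x mod uv} ψ(x) φ̄(x) π cot(π x/(uv))`.
[cite: DiamondShurman2005, §4.8 (Thm. 4.8.1)] -/
theorem twoCharOneCusp_of_eq_mul (hψ : ψ ≠ 1) (huv : u.Coprime v) {γ : SL(2, ℤ)} (c' : ℤ)
    (h : (γ 1 0 : ℤ) = v * c') (hc : IsCoprime (γ 1 0 : ℤ) u) :
    twoCharOneCusp ψ φ γ =
      ψ ((-c' : ℤ) : ZMod u) * φ⁻¹ ((γ 0 0 : ℤ) : ZMod v) *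
        ∑ x : ZMod (u * v), ψ (ZMod.castHom (dvd_mul_right u v) (ZMod u) x) *
          φ⁻¹ (ZMod.castHom (dvd_mul_left v u) (ZMod v) x) * cotConst (u * v) x := by
  rw [twoCharOneCusp_eq_add, twoCharOneCuspI_eq_zero ψ φ hψ hc, zero_add,
    twoCharOneCuspII_of_eq_mul ψ φ huv c' h]

/-! ### Bernoulli form of the cusp constants -/

/-- **The character sum `∑_{x mod uv} ψ(x) φ̄(x) π cot(π x/(uv)) = 2πi τ(Λ) B_{1,Λ̄}`**,
`Λ = ψφ̄` modulo `uv` (`ψ ≠ 𝟙` and `φ` primitive with coprime conductors, so that `Λ` is primitive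
modulo `uv ≠ 1`). [cite: DiamondShurman2005, §4.8 (Thm. 4.8.1)] -/
theorem sum_castHom_mul_cotConst_eq (hψ : ψ.IsPrimitive) (hψ1 : ψ ≠ 1) (hφ : φ.IsPrimitive)
    (huv : u.Coprime v) :
    ∑ x : ZMod (u * v), ψ (ZMod.castHom (dvd_mul_right u v) (ZMod u) x) *
        φ⁻¹ (ZMod.castHom (dvd_mul_left v u) (ZMod v) x) * cotConst (u * v) x =
      2 * π * I *
        gaussSum (DirichletCharacter.changeLevel (dvd_mul_right u v) ψ *
            DirichletCharacter.changeLevel (dvd_mul_left v u) φ⁻¹) (ZMod.stdAddChar (N := u * v)) *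
          Literature.NumberTheory.LFunctions.generalizedBernoulli 1
            (DirichletCharacter.changeLevel (dvd_mul_right u v) ψ *
              DirichletCharacter.changeLevel (dvd_mul_left v u) φ⁻¹)⁻¹ := by
  haveI : NeZero (u * v) := ⟨mul_ne_zero (NeZero.ne u) (NeZero.ne v)⟩
  set Λ := DirichletCharacter.changeLevel (dvd_mul_right u v) ψ *
    DirichletCharacter.changeLevel (dvd_mul_left v u) φ⁻¹ with hΛ
  have hΛp : Λ.IsPrimitive :=
    Literature.NumberTheory.LFunctions.isPrimitive_changeLevel_mul_changeLevel huv hψ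
      (Literature.NumberTheory.LFunctions.isPrimitive_inv φ hφ)
  have hu1 : u ≠ 1 := fun h ↦ by subst h; exact hψ1 (DirichletCharacter.level_one ψ)
  have huv1 : u * v ≠ 1 := fun h ↦ hu1 (Nat.eq_one_of_mul_eq_one_right h)
  rw [← Literature.NumberTheory.LFunctions.sum_mul_pi_mul_cot_eq_gaussSum_mul_bernoulli Λ hΛp huv1]
  refine Finset.sum_congr rfl fun x _ ↦ ?_
  have hΛx : Λ x = ψ (x.val : ZMod u) * φ⁻¹ (x.val : ZMod v) := by
    rw [hΛ]
    conv_lhs => rw [← ZMod.natCast_zmod_val x]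
    exact changeLevel_mul_changeLevel_inv_apply_natCast ψ φ x.val
  have h1 : ZMod.castHom (dvd_mul_right u v) (ZMod u) x = (x.val : ZMod u) := by
    conv_lhs => rw [← ZMod.natCast_zmod_val x]
    rw [map_natCast]
  have h2 : ZMod.castHom (dvd_mul_left v u) (ZMod v) x = (x.val : ZMod v) := by
    conv_lhs => rw [← ZMod.natCast_zmod_val x]
    rw [map_natCast]
  rw [h1, h2, hΛx, cotConst]

/-- **Constant term of `S_1^{ψ,φ} ∣₁ γ` at a cusp `a/c` with `c = v c'`, `gcd(c, u) = 1`, in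
Bernoulli form**: `ψ(-c') φ̄(a) · 2πi τ(Λ) B_{1,Λ̄}`, `Λ = ψφ̄ (mod uv)` (`ψ ≠ 𝟙`, `φ` primitive,
`gcd(u, v) = 1`). [cite: DiamondShurman2005, §4.8 (Thm. 4.8.1)] -/
theorem twoCharOneCusp_of_eq_mul_eq_bernoulli (hψ : ψ.IsPrimitive) (hψ1 : ψ ≠ 1)
    (hφ : φ.IsPrimitive) (huv : u.Coprime v) {γ : SL(2, ℤ)} (c' : ℤ)
    (h : (γ 1 0 : ℤ) = v * c') (hc : IsCoprime (γ 1 0 : ℤ) u) :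
    twoCharOneCusp ψ φ γ =
      ψ ((-c' : ℤ) : ZMod u) * φ⁻¹ ((γ 0 0 : ℤ) : ZMod v) *
        (2 * π * I *
          gaussSum (DirichletCharacter.changeLevel (dvd_mul_right u v) ψ *
              DirichletCharacter.changeLevel (dvd_mul_left v u) φ⁻¹) (ZMod.stdAddChar (N := u * v)) *
            Literature.NumberTheory.LFunctions.generalizedBernoulli 1
              (DirichletCharacter.changeLevel (dvd_mul_right u v) ψ *
                DirichletCharacter.changeLevel (dvd_mul_left v u) φ⁻¹)⁻¹) := by
  rw [twoCharOneCusp_of_eq_mul ψ φ hψ1 huv c' h hc, sum_castHom_mul_cotConst_eq ψ φ hψ hψ1 hφ huv]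

end TwoChar

end Literature.NumberTheory.EllipticCurves.ModularForms
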